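import Literature.NumberTheory.Transcendental.KZRegCalculus
import HarnessLib

/-!
# The residue invariant of the regularised Kontsevich–Zagier calculus: `KZreg.KernelConjecture` fails

`KZRegCalculus.lean` fixes the regularised calculus `KZreg` on `ℚ`-semialgebraic corner data with
UNIT tangential scales (representations `[σ, g/Π_D; D]`, regularised value
`value r = ∫ rem D (resSys r) ∅`, four moves (a) domain additivity, (b) integrand additivity,
(c) changes of variables FIXING the divergent coordinates, (d) Newton–Leibniz along a NON-divergent
last coordinate, each of (c), (d) imposed on the representation AND on every thickened face piece)
and registers the route-posed open statement
`KZreg.KernelConjecture : ∀ d, eval d = 0 → d ∈ relations` (route KontsevichZagierPeriods/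
Deregularisation, item RegKernel), noting that "every regularisation defect `regDefect r` (value `0`)
is a relation, which the four moves of this version do not obviously provide".

This file settles that doubt in the negative: **`KZreg.KernelConjecture` is false**
(`KZreg.not_kernelConjecture`). The four moves preserve not only the regularised value but a second
additive functional, the RESIDUE VALUE
`res [r] = ∑_{i ∈ D} ∫ rem D (resSys r) {i}` — the sum over the codimension-one divergence faces
`{tᵢ = 1}` of the regularised integrals of the residues (Dupont–Panzer–Pym: the regularised integral
of the residue form along a boundary stratum, again computed in the corner chart, Ex. 7.13 iterated
by Cor. 7.10) — and `eval` forgets it. The file's own worked example, the unit pole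
`unitPole = [(0,1), dt/(1-t); D = {0}]`, has `eval = reg ∫₀¹ dt/(1-t) = 0` (`value_unitPole`) but
residue value `∫₀¹ 1 dt = 1`, so `[unitPole] ∈ ker eval ∖ relations`
(`of_unitPole_not_mem_relations`); equivalently its regularisation defect
`regDefect unitPole = [unitPole] - incl [(0,1), 0]` is not a relation
(`regDefect_unitPole_not_mem_relations`).

Why `res` kills the moves (`relations_le_ker_res`):
* (a), (b): uniqueness of residues (`IsResidueSystem.ae_eq`) and extension by zero, verbatim as for
  the value (`IsResidueSystem.resValue_eq_add` is `regValue_eq_add` with `rem · {i}` for `rem · ∅`);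
* (c), (d): for `i ∈ D` the FACE REPRESENTATION `face r i = [cyl {i} σ, g ∘ faceMap {i}; D ∖ {i}]`
  is an honest regularised representation whose residue system is the face system
  `V ↦ resSys r (insert i V)` (`IntegralRep.resSys_face`), so that `value (face r i) = ∫ rem D ρ {i}`
  (`IntegralRep.value_face`); and since the moves (c), (d) carry their data on every thickened face
  piece, the pair of faces of an instance of (c) (resp. (d)) is again an instance of (c) (resp. (d))
  (`face_sub_face_mem_changeOfVariablesRel`, `face_sub_face_mem_newtonLeibnizRel`), to which the
  soundness theorems of `KZRegCalculus.lean` apply.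

Consequence for the route: the calculus `KZreg` of this version has no move paying a pure
divergence — Dupont–Panzer–Pym's regularised Stokes formula ACROSS a divergence face (op. cit.
§5.3; Cor. 7.11 with a polar boundary stratum) and changes of scale are "not moves of this version"
(module docstring of `KZRegCalculus.lean`) — so `ker eval = relations` can only hold for an enlarged
move set. The smallest enlargement suggested by the counterexample adjoins the subgroup `defects`
generated by the `regDefect r`; no new open statement is registered (statement items are the
planner's), but it is PROVED here that the repaired kernel statement `ker eval ≤ relations ⊔ defects`
follows from the ordinary kernel conjecture `KZKernelConjecture` (`ker_eval_le_relations_sup_defects`,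
by `d = incl (Λ d) + (d - incl (Λ d))`, `eval_Λ`, `map_relations_le`) and that
`Conservative ∧ (ker eval ≤ relations ⊔ defects) ↔ KZKernelConjecture`
(`conservative_and_ker_le_iff`): the regularised detour is then exactly summit-strength.

Sources: C. Dupont, E. Panzer, B. Pym, *Regularized integrals and manifolds with log corners*,
J. Éc. polytech. Math. 13 (2026) [DupontPanzerPym2026], Ex. 7.13, Cor. 7.9–7.11 (as vendored in
`KZRegCalculus.lean`); M. Kontsevich, D. Zagier, *Periods* (2001), §1.2 [KontsevichZagierPeriods2001].
The statement refuted is posed by route KontsevichZagierPeriods/Deregularisation of this project and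
is not in print; the residue-value bookkeeping of this file is elementary and this project's.

Design: new data are the face representation `IntegralRep.face` (a `KZreg.IntegralRep`), the
real-valued functionals `KZreg.resValue` (abstract residue systems), `IntegralRep.resValue`,
`KZreg.res : FormalRep →+ ℝ`, and the subgroup `KZreg.defects`; no new `Prop`-valued definitions
(no named facts, no open statements).
-/

noncomputable section

open MeasureTheory Set Filter
open scoped BigOperators Topology ENNReal
open Literature.ModelTheory.ExponentialFields (IsSemialgebraic)

namespace Literature.NumberTheory.Transcendental

namespace KZreg

variable {n : ℕ}

/-! ### Remainders only see the residues of the faces inside `D` -/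

/-- Two residue systems agreeing on the faces `U ⊆ D` have the same remainders `rem D · S`,
`S ⊆ D`. [folklore] -/
theorem rem_congr {D : Finset (Fin n)} {ρ ρ' : Finset (Fin n) → (Fin n → ℝ) → ℝ}
    (h : ∀ U, U ⊆ D → ρ U = ρ' U) {S : Finset (Fin n)} (hS : S ⊆ D) :
    rem D ρ S = rem D ρ' S := by
  funext t
  simp only [rem]
  refine Finset.sum_congr rfl fun T hT => ?_
  rw [h (S ∪ T) (Finset.union_subset hS ((Finset.mem_powerset.1 hT).trans Finset.sdiff_subset))]

/-! ### The residue value of a residue system -/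

/-- The RESIDUE VALUE of a residue system `ρ` relative to `D`: the sum over the codimension-one
divergence faces `{tᵢ = 1}`, `i ∈ D`, of the regularised values `∫ rem D ρ {i}` of the face
residues (each computed, like the value itself, by collar subtraction of the deeper residues:
Dupont–Panzer–Pym's regularised integral of the residue form along the stratum, in the corner
chart). [cite: DupontPanzerPym2026, Ex. 7.13] -/
def resValue (D : Finset (Fin n)) (ρ : Finset (Fin n) → (Fin n → ℝ) → ℝ) : ℝ :=
  ∑ i ∈ D, ∫ t, rem D ρ {i} t

namespace IsResidueSystem

variable {D D' : Finset (Fin n)} {ρ ρ' : Finset (Fin n) → (Fin n → ℝ) → ℝ}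

/-- The residue value is unchanged by extension by zero (the new faces carry the zero residue).
[folklore] -/
theorem resValue_extendZero (hDD' : D ⊆ D') :
    resValue D' (extendZero D ρ) = resValue D ρ := by
  unfold resValue
  have h1 : ∑ i ∈ D', (∫ t, rem D' (extendZero D ρ) {i} t) =
      ∑ i ∈ D, ∫ t, rem D' (extendZero D ρ) {i} t := by
    symm
    refine Finset.sum_subset hDD' fun i _ hiD => ?_
    rw [rem_extendZero_of_not_subset {i} (fun h => hiD (Finset.singleton_subset_iff.1 h))]
    simp
  rw [h1]
  exact Finset.sum_congr rfl fun i hi => by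
    rw [rem_extendZero hDD' {i} (Finset.singleton_subset_iff.2 hi)]

/-- **The residue value depends only on the a.e.-class of the function regularised** (same `D`):
uniqueness of residues. [folklore] -/
theorem resValue_congr (h : IsResidueSystem D ρ) (h' : IsResidueSystem D ρ')
    (h0 : ρ ∅ =ᵐ[volume] ρ' ∅) : resValue D ρ = resValue D ρ' := by
  unfold resValue
  exact Finset.sum_congr rfl fun i hi => integral_congr_ae
    (rem_ae_eq (ae_eq D.card D ρ ρ' rfl h h' h0) {i} (Finset.singleton_subset_iff.2 hi))

/-- The residue value depends only on the a.e.-class of the function regularised, for possibly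
different sets of divergent coordinates (extend both systems by zero to `D ∪ D'`). [folklore] -/
theorem resValue_congr' {D' : Finset (Fin n)} (h : IsResidueSystem D ρ)
    (h' : IsResidueSystem D' ρ') (h0 : ρ ∅ =ᵐ[volume] ρ' ∅) :
    resValue D ρ = resValue D' ρ' := by
  have e1 : resValue D ρ = resValue (D ∪ D') (extendZero D ρ) :=
    (resValue_extendZero (ρ := ρ) (Finset.subset_union_left (s₂ := D'))).symm
  have e2 : resValue D' ρ' = resValue (D ∪ D') (extendZero D' ρ') :=
    (resValue_extendZero (ρ := ρ') (Finset.subset_union_right (s₁ := D))).symm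
  rw [e1, e2]
  refine resValue_congr (h.extend Finset.subset_union_left) (h'.extend Finset.subset_union_right) ?_
  rwa [extendZero_of_subset (Finset.empty_subset _), extendZero_of_subset (Finset.empty_subset _)]

/-- **Additivity of residue values**: if `ρ ∅ = ρ₁ ∅ + ρ₂ ∅` a.e. for three admissible systems
(relative to possibly different divergent coordinates), then the residue values add. [folklore] -/
theorem resValue_eq_add {D₁ D₂ : Finset (Fin n)} {ρ₁ ρ₂ : Finset (Fin n) → (Fin n → ℝ) → ℝ}
    (h : IsResidueSystem D ρ) (h₁ : IsResidueSystem D₁ ρ₁) (h₂ : IsResidueSystem D₂ ρ₂)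
    (h0 : ρ ∅ =ᵐ[volume] ρ₁ ∅ + ρ₂ ∅) :
    resValue D ρ = resValue D₁ ρ₁ + resValue D₂ ρ₂ := by
  set E := D₁ ∪ D₂
  have h₁' := h₁.extend (Finset.subset_union_left (s₂ := D₂))
  have h₂' := h₂.extend (Finset.subset_union_right (s₁ := D₁))
  have hsum := h₁'.add h₂'
  have h0' : ρ ∅ =ᵐ[volume] (extendZero D₁ ρ₁ + extendZero D₂ ρ₂) ∅ := by
    simpa [extendZero_of_subset (Finset.empty_subset D₁),
      extendZero_of_subset (Finset.empty_subset D₂)] using h0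
  have e1 : resValue D₁ ρ₁ = resValue E (extendZero D₁ ρ₁) :=
    (resValue_extendZero (ρ := ρ₁) (Finset.subset_union_left (s₂ := D₂))).symm
  have e2 : resValue D₂ ρ₂ = resValue E (extendZero D₂ ρ₂) :=
    (resValue_extendZero (ρ := ρ₂) (Finset.subset_union_right (s₁ := D₁))).symm
  rw [resValue_congr' h hsum h0', e1, e2]
  unfold resValue
  rw [← Finset.sum_add_distrib]
  refine Finset.sum_congr rfl fun i hi => ?_
  rw [rem_add]
  simp only [Pi.add_apply]
  exact integral_add (h₁'.integrable_rem {i} (Finset.singleton_subset_iff.2 hi))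
    (h₂'.integrable_rem {i} (Finset.singleton_subset_iff.2 hi))

end IsResidueSystem

/-! ### Faces of faces: iterated thickening and the face integrands of a face -/

/-- Thickening a set first in the directions `U` and then in the disjoint directions `V` is
thickening it in the directions `U ∪ V`: `cyl V (cyl U σ) = cyl (U ∪ V) σ`. [folklore] -/
theorem cyl_cyl {U V : Finset (Fin n)} (hUV : Disjoint U V) (σ : Set (Fin n → ℝ)) :
    cyl V (cyl U σ) = cyl (U ∪ V) σ := by
  ext t
  constructor
  · intro ht
    obtain ⟨hV, u, hu, huV⟩ := mem_cyl_iff.1 ht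
    obtain ⟨hU, s, hs, hsU⟩ := mem_cyl_iff.1 hu
    rw [mem_cyl_iff]
    refine ⟨fun i hi => ?_, s, hs, ?_⟩
    · rcases Finset.mem_union.1 hi with hiU | hiV
      · have hiV : i ∉ V := Finset.disjoint_left.1 hUV hiU
        have := congr_fun huV i
        rw [faceMap_apply_of_not_mem hiV, faceMap_apply_of_not_mem hiV] at this
        rw [← this]
        exact hU i hiU
      · exact hV i hiV
    · calc faceMap (U ∪ V) s = faceMap V (faceMap U s) := by
              rw [faceMap_faceMap, Finset.union_comm]
        _ = faceMap V (faceMap U u) := by rw [hsU]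
        _ = faceMap U (faceMap V u) := by
              rw [faceMap_faceMap, faceMap_faceMap, Finset.union_comm]
        _ = faceMap U (faceMap V t) := by rw [huV]
        _ = faceMap (U ∪ V) t := by rw [faceMap_faceMap]
  · intro ht
    obtain ⟨hUV', s, hs, hst⟩ := mem_cyl_iff.1 ht
    rw [mem_cyl_iff]
    refine ⟨fun i hi => hUV' i (Finset.mem_union_right _ hi),
      fun j => if j ∈ V then s j else t j, ?_, ?_⟩
    · rw [mem_cyl_iff]
      refine ⟨fun i hiU => ?_, s, hs, ?_⟩
      · have hiV : i ∉ V := Finset.disjoint_left.1 hUV hiU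
        simp only [hiV, if_false]
        exact hUV' i (Finset.mem_union_left _ hiU)
      · ext j
        by_cases hjU : j ∈ U
        · rw [faceMap_apply_of_mem hjU, faceMap_apply_of_mem hjU]
        · rw [faceMap_apply_of_not_mem hjU, faceMap_apply_of_not_mem hjU]
          by_cases hjV : j ∈ V
          · simp [hjV]
          · simp only [hjV, if_false]
            have hjUV : j ∉ U ∪ V := by simp [hjU, hjV]
            have := congr_fun hst j
            rwa [faceMap_apply_of_not_mem hjUV, faceMap_apply_of_not_mem hjUV] at this
    · ext j
      by_cases hjV : j ∈ V
      · rw [faceMap_apply_of_mem hjV, faceMap_apply_of_mem hjV]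
      · rw [faceMap_apply_of_not_mem hjV, faceMap_apply_of_not_mem hjV]
        simp [hjV]

/-- Thickening in one further direction `i ∉ V`: `cyl V (cyl {i} σ) = cyl (insert i V) σ`.
[folklore] -/
theorem cyl_cyl_singleton {i : Fin n} {V : Finset (Fin n)} (hiV : i ∉ V) (σ : Set (Fin n → ℝ)) :
    cyl V (cyl {i} σ) = cyl (insert i V) σ := by
  rw [cyl_cyl (Finset.disjoint_singleton_left.2 hiV), Finset.insert_eq]

/-- Index bookkeeping: `(D ∖ {i}) ∖ V = D ∖ ({i} ∪ V)`. [folklore] -/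
theorem erase_sdiff_eq_sdiff_insert (D V : Finset (Fin n)) (i : Fin n) :
    D.erase i \ V = D \ insert i V := by
  ext j
  simp only [Finset.mem_sdiff, Finset.mem_erase, Finset.mem_insert, not_or]
  tauto

/-- The face integrands of the face data `(g ∘ faceMap {i}, D ∖ {i})` along `V ∌ i` are the face
integrands of `(g, D)` along `insert i V`. [folklore] -/
theorem faceIntegrand_comp_faceMap_singleton (g : (Fin n → ℝ) → ℝ) (D V : Finset (Fin n))
    (i : Fin n) :
    faceIntegrand (fun s => g (faceMap {i} s)) (D.erase i) V = faceIntegrand g D (insert i V) := by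
  funext t
  simp only [faceIntegrand]
  rw [faceMap_faceMap, ← Finset.insert_eq, erase_sdiff_eq_sdiff_insert]

/-- The residue system of the face data `(cyl {i} σ, g ∘ faceMap {i}, D ∖ {i})` is the face system
`V ↦ resSys σ g D (insert i V)` (on the faces `V ∌ i`). [folklore] -/
theorem resSys_cyl_singleton (σ : Set (Fin n → ℝ)) (g : (Fin n → ℝ) → ℝ) (D : Finset (Fin n))
    {i : Fin n} {V : Finset (Fin n)} (hiV : i ∉ V) :
    resSys (cyl {i} σ) (fun s => g (faceMap {i} s)) (D.erase i) V = resSys σ g D (insert i V) := by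
  simp only [resSys]
  rw [cyl_cyl_singleton hiV, faceIntegrand_comp_faceMap_singleton]

/-! ### The face representation along a divergent coordinate -/

namespace IntegralRep

/-- The **face representation** of `r = [σ, g/Π_D; D]` along a divergent coordinate `i ∈ D`:
domain the thickened face piece `cyl {i} σ` (the footprint on `{tᵢ = 1}` times the unit collar),
numerator the residue numerator `g ∘ faceMap {i}`, divergent coordinates `D ∖ {i}`. It is the
regularised representation of the residue of the integrand along the face (thickened by the unit
collar, so still `n`-dimensional), and it is admissible because its residue system is the face
system of `r` (`resSys_face`; `IsResidueSystem.face`).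
[cite: DupontPanzerPym2026, Ex. 7.13] -/
def face (r : IntegralRep n) {i : Fin n} (hi : i ∈ r.div) : IntegralRep n where
  domain := cyl {i} r.domain
  num := fun t => r.num (faceMap {i} t)
  div := r.div.erase i
  lt_one t ht j hj :=
    r.lt_one_of_mem_cyl ht (Finset.mem_of_mem_erase hj)
      (fun h => Finset.ne_of_mem_erase hj (Finset.mem_singleton.1 h))
  isSemialgebraic_domain := isSemialgebraic_cyl {i} r.isSemialgebraic_domain
  isSemialgebraicFunOn_num T hT := by
    have hTi : insert i T ⊆ r.div := Finset.insert_subset hi (hT.trans (Finset.erase_subset _ _))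
    have hs : IsSemialgebraic ℚ (faceImage T (cyl {i} r.domain)) :=
      isSemialgebraic_faceImage T (isSemialgebraic_cyl {i} r.isSemialgebraic_domain)
    have hmaps : MapsTo (faceMap {i}) (faceImage T (cyl {i} r.domain))
        (faceImage (insert i T) r.domain) := by
      intro x hx
      obtain ⟨u, hu, rfl⟩ : ∃ u ∈ cyl {i} r.domain, faceMap T u = x := hx
      obtain ⟨-, s, hs, hsu⟩ := mem_cyl_iff.1 hu
      refine ⟨s, hs, ?_⟩
      calc faceMap (insert i T) s = faceMap T (faceMap {i} s) := by
              rw [faceMap_faceMap, Finset.union_comm, ← Finset.insert_eq]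
        _ = faceMap T (faceMap {i} u) := by rw [hsu]
        _ = faceMap {i} (faceMap T u) := by
              rw [faceMap_faceMap, faceMap_faceMap, Finset.union_comm]
    exact IsSemialgebraicFunOn.comp_isSemialgebraicMapOn_holds (r.isSemialgebraicFunOn_num _ hTi)
      (isSemialgebraicMapOn_faceMap {i} hs) hmaps
  integrable_rem S hS := by
    have hkey : ∀ U, U ⊆ r.div.erase i →
        KZreg.resSys (cyl {i} r.domain) (fun t => r.num (faceMap {i} t)) (r.div.erase i) U =
          r.resSys (insert i U) := fun U hU =>
      resSys_cyl_singleton r.domain r.num r.div (fun h => (Finset.mem_erase.1 (hU h)).1 rfl)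
    rw [rem_congr (ρ' := fun V => r.resSys (insert i V)) hkey hS, IsResidueSystem.rem_face]
    exact r.integrable_rem (insert i S)
      (Finset.insert_subset hi (hS.trans (Finset.erase_subset _ _)))

variable (r : IntegralRep n) {i : Fin n} (hi : i ∈ r.div)

/-- The domain of the face representation is the thickened face piece. [folklore] -/
@[simp] theorem face_domain : (r.face hi).domain = cyl {i} r.domain := rfl

/-- The numerator of the face representation is the residue numerator. [folklore] -/
@[simp] theorem face_num : (r.face hi).num = fun t => r.num (faceMap {i} t) := rfl

/-- The divergent coordinates of the face representation. [folklore] -/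
@[simp] theorem face_div : (r.face hi).div = r.div.erase i := rfl

/-- **The residue system of the face representation is the face system** `V ↦ resSys r (insert i V)`
(on the faces `V ∌ i`). [folklore] -/
theorem resSys_face {V : Finset (Fin n)} (hiV : i ∉ V) :
    (r.face hi).resSys V = r.resSys (insert i V) :=
  resSys_cyl_singleton r.domain r.num r.div hiV

/-- The subtracted integrand of the face representation is the remainder of the face `{i}`.
[folklore] -/
theorem subIntegrand_face : (r.face hi).subIntegrand = rem r.div r.resSys {i} := by
  have hkey : ∀ U, U ⊆ (r.face hi).div → (r.face hi).resSys U = r.resSys (insert i U) :=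
    fun U hU => r.resSys_face hi (fun h => (Finset.mem_erase.1 (hU h)).1 rfl)
  rw [IntegralRep.subIntegrand, rem_congr (ρ' := fun V => r.resSys (insert i V)) hkey
    (Finset.empty_subset _)]
  show rem (r.div.erase i) (fun V => r.resSys (insert i V)) ∅ = rem r.div r.resSys {i}
  rw [IsResidueSystem.rem_face]
  simp

/-- **The value of the face representation** is the regularised face integral `∫ rem D ρ {i}` of
the residue along `{tᵢ = 1}`. [cite: DupontPanzerPym2026, Ex. 7.13] -/
theorem value_face : (r.face hi).value = ∫ t, rem r.div r.resSys {i} t := by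
  rw [IntegralRep.value, subIntegrand_face]

/-- The RESIDUE VALUE of a regularised representation: `∑_{i ∈ D} ∫ rem D (resSys r) {i}`, the sum
of the values of its face representations. [cite: DupontPanzerPym2026, Ex. 7.13] -/
def resValue (r : IntegralRep n) : ℝ := KZreg.resValue r.div r.resSys

/-- Unfolding the residue value. [folklore] -/
theorem resValue_eq (r : IntegralRep n) :
    r.resValue = ∑ i ∈ r.div, ∫ t, rem r.div r.resSys {i} t := rfl

/-- The residue value is the residue value of the residue system. [folklore] -/
theorem resValue_eq_resValue (r : IntegralRep n) : r.resValue = KZreg.resValue r.div r.resSys := rfl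

end IntegralRep

/-! ### The residue functional on the formal group -/

/-- The RESIDUE FUNCTIONAL `[r] ↦ resValue r`, extended additively to formal `ℤ`-combinations.
[folklore] -/
def res : FormalRep →+ ℝ := FreeAbelianGroup.lift fun r => r.2.resValue

/-- `res [r] = resValue r`. [folklore] -/
@[simp] theorem res_of (r : IntegralRep n) : res (of r) = r.resValue :=
  FreeAbelianGroup.lift_apply_of _ _

/-! ### The residue functional vanishes on the four moves -/

/-- The a.e. identity behind move (a): the zero-extended integrand of `σ = σ₁ ∪ σ₂` (null overlap)
is the sum of those of the pieces. [folklore] -/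
theorem IntegralRep.resSys_empty_ae_of_union {r r₁ r₂ : IntegralRep n}
    (hdom : r.domain = r₁.domain ∪ r₂.domain) (hvol : volume (r₁.domain ∩ r₂.domain) = 0)
    (h₁ : EqOn r.integrand r₁.integrand r₁.domain) (h₂ : EqOn r.integrand r₂.integrand r₂.domain) :
    r.resSys ∅ =ᵐ[volume] r₁.resSys ∅ + r₂.resSys ∅ := by
  rw [IntegralRep.resSys_empty, IntegralRep.resSys_empty, IntegralRep.resSys_empty]
  have hae : ∀ᵐ t ∂(volume : Measure (Fin n → ℝ)), t ∉ r₁.domain ∩ r₂.domain := by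
    rw [ae_iff]; simpa using hvol
  filter_upwards [hae] with t ht
  simp only [Pi.add_apply]
  by_cases ht1 : t ∈ r₁.domain
  · have ht2 : t ∉ r₂.domain := fun h => ht ⟨ht1, h⟩
    have htr : t ∈ r.domain := by rw [hdom]; exact Or.inl ht1
    rw [indicator_of_mem htr, indicator_of_mem ht1, indicator_of_notMem ht2, add_zero, h₁ ht1]
  · by_cases ht2 : t ∈ r₂.domain
    · have htr : t ∈ r.domain := by rw [hdom]; exact Or.inr ht2
      rw [indicator_of_mem htr, indicator_of_notMem ht1, indicator_of_mem ht2, zero_add, h₂ ht2]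
    · have htr : t ∉ r.domain := by
        rw [hdom]; rintro (h | h) <;> contradiction
      rw [indicator_of_notMem htr, indicator_of_notMem ht1, indicator_of_notMem ht2, add_zero]

/-- The a.e. identity behind move (b): the zero-extended integrand of `f₁ + f₂` on `σ` is the sum of
those of `f₁` and `f₂`. [folklore] -/
theorem IntegralRep.resSys_empty_ae_of_add {r r₁ r₂ : IntegralRep n}
    (h₁ : r₁.domain = r.domain) (h₂ : r₂.domain = r.domain)
    (hadd : EqOn r.integrand (r₁.integrand + r₂.integrand) r.domain) :
    r.resSys ∅ =ᵐ[volume] r₁.resSys ∅ + r₂.resSys ∅ := by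
  rw [IntegralRep.resSys_empty, IntegralRep.resSys_empty, IntegralRep.resSys_empty, h₁, h₂]
  refine Filter.Eventually.of_forall fun t => ?_
  simp only [Pi.add_apply]
  by_cases ht : t ∈ r.domain
  · rw [indicator_of_mem ht, indicator_of_mem ht, indicator_of_mem ht]
    exact hadd ht
  · simp [indicator_of_notMem ht]

/-- **`res` vanishes on move (a)** (additivity of residue values under a.e.-additive decompositions
of the zero-extended integrand). [folklore] -/
theorem res_eq_zero_of_mem_domainAddRel {c : FormalRep} (hc : c ∈ domainAddRel) : res c = 0 := by
  obtain ⟨n, r, r₁, r₂, hdom, hvol, h₁, h₂, rfl⟩ := hc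
  simp only [map_sub, res_of]
  rw [sub_sub, sub_eq_zero, IntegralRep.resValue_eq_resValue, IntegralRep.resValue_eq_resValue,
    IntegralRep.resValue_eq_resValue]
  exact IsResidueSystem.resValue_eq_add r.isResidueSystem r₁.isResidueSystem r₂.isResidueSystem
    (IntegralRep.resSys_empty_ae_of_union hdom hvol h₁ h₂)

/-- **`res` vanishes on move (b)**. [folklore] -/
theorem res_eq_zero_of_mem_integrandAddRel {c : FormalRep} (hc : c ∈ integrandAddRel) :
    res c = 0 := by
  obtain ⟨n, r, r₁, r₂, h₁, h₂, hadd, rfl⟩ := hc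
  simp only [map_sub, res_of]
  rw [sub_sub, sub_eq_zero, IntegralRep.resValue_eq_resValue, IntegralRep.resValue_eq_resValue,
    IntegralRep.resValue_eq_resValue]
  exact IsResidueSystem.resValue_eq_add r.isResidueSystem r₁.isResidueSystem r₂.isResidueSystem
    (IntegralRep.resSys_empty_ae_of_add h₁ h₂ hadd)

/-- **The faces of a change of variables fixing the divergent coordinates form again such a change
of variables**: the data `Φ_{insert i V}` on the thickened face pieces `cyl (insert i V) σ =
cyl V (cyl {i} σ)` serve the face representations along `i`. [cite: DupontPanzerPym2026, Cor. 7.9] -/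
theorem face_sub_face_mem_changeOfVariablesRel {r r' : IntegralRep n}
    {Φ : Finset (Fin n) → (Fin n → ℝ) → (Fin n → ℝ)}
    {Φ' : Finset (Fin n) → (Fin n → ℝ) → (Fin n → ℝ) →L[ℝ] (Fin n → ℝ)}
    (hdiv : r'.div = r.div)
    (hT : ∀ T, T ⊆ r.div →
      IsSemialgebraicMapOn ℚ (cyl T r.domain) (Φ T) ∧
      (∀ x ∈ cyl T r.domain, HasFDerivWithinAt (Φ T) (Φ' T x) (cyl T r.domain) x) ∧
      InjOn (Φ T) (cyl T r.domain) ∧ cyl T r'.domain = Φ T '' cyl T r.domain ∧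
      (∀ x ∈ cyl T r.domain, ∀ i ∈ r.div, Φ T x i = x i) ∧
      (∀ x ∈ cyl T r.domain, faceIntegrand r.num r.div T x =
        faceIntegrand r'.num r'.div T (Φ T x) * |(Φ' T x).det|))
    {i : Fin n} (hi : i ∈ r.div) (hi' : i ∈ r'.div) :
    of (r.face hi) - of (r'.face hi') ∈ changeOfVariablesRel := by
  refine ⟨n, r.face hi, r'.face hi', fun V => Φ (insert i V), fun V => Φ' (insert i V), ?_, ?_,
    rfl⟩
  · simp only [IntegralRep.face_div, hdiv]
  · intro V hV
    simp only [IntegralRep.face_div] at hV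
    have hiV : i ∉ V := fun h => (Finset.mem_erase.1 (hV h)).1 rfl
    have hVD : insert i V ⊆ r.div := Finset.insert_subset hi (hV.trans (Finset.erase_subset _ _))
    obtain ⟨hsa, hderiv, hinj, himg, hfix, hf⟩ := hT (insert i V) hVD
    simp only [IntegralRep.face_domain, IntegralRep.face_num, IntegralRep.face_div,
      cyl_cyl_singleton hiV, faceIntegrand_comp_faceMap_singleton]
    exact ⟨hsa, hderiv, hinj, himg, fun x hx j hj => hfix x hx j (Finset.mem_of_mem_erase hj), hf⟩

/-- **`res` vanishes on move (c)**: termwise over `i ∈ D`, the values of the face representations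
of `r` and `r'` agree by soundness of (c) applied to the pair of faces. [cite: DupontPanzerPym2026, Cor. 7.9] -/
theorem res_eq_zero_of_mem_changeOfVariablesRel {c : FormalRep} (hc : c ∈ changeOfVariablesRel) :
    res c = 0 := by
  obtain ⟨n, r, r', Φ, Φ', hdiv, hT, rfl⟩ := hc
  simp only [map_sub, res_of, sub_eq_zero, IntegralRep.resValue_eq]
  rw [hdiv]
  refine Finset.sum_congr rfl fun i hi => ?_
  have hi' : i ∈ r'.div := by rw [hdiv]; exact hi
  have hv := r.value_face hi
  have hv' := r'.value_face hi'
  rw [hdiv] at hv'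
  rw [← hv, ← hv']
  have h0 := eval_eq_zero_of_mem_changeOfVariablesRel
    (face_sub_face_mem_changeOfVariablesRel hdiv hT hi hi')
  rwa [map_sub, eval_of, eval_of, sub_eq_zero] at h0

/-- **The faces of a Newton–Leibniz move along a non-divergent last coordinate form again such a
move**: the data `(a, b, F)_{insert j V}` on the thickened face pieces serve the face
representations along `j` (base) and `Fin.castSucc j` (band). [cite: DupontPanzerPym2026, Cor. 7.11] -/
theorem face_sub_face_mem_newtonLeibnizRel {r : IntegralRep (n + 1)} {r' : IntegralRep n}
    {a b : Finset (Fin n) → (Fin n → ℝ) → ℝ} {F : Finset (Fin n) → (Fin (n + 1) → ℝ) → ℝ}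
    (hdiv : r.div = r'.div.map Fin.castSuccEmb)
    (hT : ∀ T, T ⊆ r'.div →
      IsSemialgebraicFunOn ℚ (cyl (T.map Fin.castSuccEmb) r.domain) (F T) ∧
      IsSemialgebraicFunOn ℚ (cyl T r'.domain) (a T) ∧
      IsSemialgebraicFunOn ℚ (cyl T r'.domain) (b T) ∧
      (∀ x ∈ cyl T r'.domain, a T x ≤ b T x) ∧
      cyl (T.map Fin.castSuccEmb) r.domain =
        {z | (Fin.init z : Fin n → ℝ) ∈ cyl T r'.domain ∧ a T (Fin.init z) ≤ z (Fin.last n) ∧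
          z (Fin.last n) ≤ b T (Fin.init z)} ∧
      (∀ x ∈ cyl T r'.domain,
        ContinuousOn (fun t : ℝ => F T (Fin.snoc x t)) (Icc (a T x) (b T x))) ∧
      (∀ x ∈ cyl T r'.domain, ∀ t ∈ Ioo (a T x) (b T x),
        HasDerivAt (fun s : ℝ => F T (Fin.snoc x s))
          (faceIntegrand r.num r.div (T.map Fin.castSuccEmb) (Fin.snoc x t)) t) ∧
      (∀ x ∈ cyl T r'.domain, faceIntegrand r'.num r'.div T x =
        F T (Fin.snoc x (b T x)) - F T (Fin.snoc x (a T x))))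
    {j : Fin n} (hj : j ∈ r'.div) (hj' : Fin.castSuccEmb j ∈ r.div) :
    of (r.face hj') - of (r'.face hj) ∈ newtonLeibnizRel := by
  refine ⟨n, r.face hj', r'.face hj, fun V => a (insert j V), fun V => b (insert j V),
    fun V => F (insert j V), ?_, ?_, rfl⟩
  · simp only [IntegralRep.face_div, hdiv, Finset.map_erase]
  · intro V hV
    simp only [IntegralRep.face_div] at hV
    have hjV : j ∉ V := fun h => (Finset.mem_erase.1 (hV h)).1 rfl
    have hjV' : Fin.castSuccEmb j ∉ V.map Fin.castSuccEmb := by simpa using hjV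
    have hVD : insert j V ⊆ r'.div := Finset.insert_subset hj (hV.trans (Finset.erase_subset _ _))
    obtain ⟨hF, ha, hb, hab, hband, hcont, hder, hbd⟩ := hT (insert j V) hVD
    have hmap : insert (Fin.castSuccEmb j) (V.map Fin.castSuccEmb) =
        (insert j V).map Fin.castSuccEmb := (Finset.map_insert _ _ _).symm
    simp only [IntegralRep.face_domain, IntegralRep.face_num, IntegralRep.face_div,
      cyl_cyl_singleton hjV, cyl_cyl_singleton hjV', faceIntegrand_comp_faceMap_singleton, hmap]
    exact ⟨hF, ha, hb, hab, hband, hcont, hder, hbd⟩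

/-- **`res` vanishes on move (d)**: termwise over `j ∈ D`, by soundness of (d) applied to the pair
of faces. [cite: DupontPanzerPym2026, Cor. 7.11] -/
theorem res_eq_zero_of_mem_newtonLeibnizRel {c : FormalRep} (hc : c ∈ newtonLeibnizRel) :
    res c = 0 := by
  obtain ⟨n, r, r', a, b, F, hdiv, hT, rfl⟩ := hc
  simp only [map_sub, res_of, sub_eq_zero, IntegralRep.resValue_eq]
  rw [hdiv, Finset.sum_map]
  refine Finset.sum_congr rfl fun j hj => ?_
  have hj' : Fin.castSuccEmb j ∈ r.div := by rw [hdiv]; exact Finset.mem_map_of_mem _ hj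
  have hv := r.value_face hj'
  rw [hdiv] at hv
  have hv' := r'.value_face hj
  rw [← hv, ← hv']
  have h0 := eval_eq_zero_of_mem_newtonLeibnizRel (face_sub_face_mem_newtonLeibnizRel hdiv hT hj hj')
  rwa [map_sub, eval_of, eval_of, sub_eq_zero] at h0

/-- **The residue functional vanishes on all relations of the regularised calculus.** [folklore] -/
theorem relations_le_ker_res : relations ≤ res.ker := by
  rw [relations]
  refine (AddSubgroup.closure_le _).mpr ?_
  rintro c (((hc | hc) | hc) | hc)
  · exact res_eq_zero_of_mem_domainAddRel hc
  · exact res_eq_zero_of_mem_integrandAddRel hc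
  · exact res_eq_zero_of_mem_changeOfVariablesRel hc
  · exact res_eq_zero_of_mem_newtonLeibnizRel hc

/-- Equivalent regularised representations have the same residue value. [folklore] -/
theorem Equivalent.resValue_eq {m : ℕ} {r : IntegralRep n} {r' : IntegralRep m}
    (h : Equivalent r r') : r.resValue = r'.resValue := by
  have := relations_le_ker_res h
  rwa [AddMonoidHom.mem_ker, map_sub, res_of, res_of, sub_eq_zero] at this

/-- Ordinary representations (`D = ∅`) have residue value `0`. [folklore] -/
theorem resValue_ofKZ (r : KZ.IntegralRep n) : (ofKZ r).resValue = 0 := by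
  rw [IntegralRep.resValue_eq, ofKZ_div, Finset.sum_empty]

/-- The residue functional vanishes on the ordinary calculus: `res ∘ incl = 0`. [folklore] -/
theorem res_incl (c : KZ.FormalRep) : res (incl c) = 0 := by
  suffices h : res.comp incl = 0 from DFunLike.congr_fun h c
  refine FreeAbelianGroup.lift_ext _ _ ?_
  rintro ⟨n, r⟩
  change res (incl (KZ.of r)) = 0
  rw [incl_of, res_of, resValue_ofKZ]

/-- The residue functional of a regularisation defect is the residue value:
`res (regDefect r) = resValue r`. [folklore] -/
theorem res_regDefect (r : IntegralRep n) : res (regDefect r) = r.resValue := by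
  rw [regDefect, map_sub, res_of, res_incl, sub_zero]

/-! ### The unit pole has residue value `1`: `KernelConjecture` fails -/

/-- The residue of the unit pole along its face is the indicator of the unit interval.
[cite: DupontPanzerPym2026, Ex. 7.13] -/
theorem rem_unitPole_singleton : rem {0} unitPole.resSys {0} = unitIoo.indicator 1 := by
  show rem {0} (KZreg.resSys unitIoo (fun _ => (1 : ℝ)) {0}) {0} = unitIoo.indicator 1
  funext t
  simp only [rem, Finset.sdiff_self, Finset.powerset_empty, Finset.sum_singleton,
    Finset.card_empty, pow_zero, Finset.union_empty, divProd_empty, div_one, one_mul, resSys,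
    cyl_zero_unitIoo]
  by_cases ht : t ∈ unitIoo
  · simp [indicator_of_mem ht, faceIntegrand]
  · simp [indicator_of_notMem ht]

/-- The open unit interval of `ℝ¹` has volume `1`. [folklore] -/
theorem volume_unitIoo : volume unitIoo = 1 := by
  have : unitIoo = Set.pi univ fun _ : Fin 1 => Ioo (0 : ℝ) 1 := by
    ext t
    simp [unitIoo, Fin.forall_fin_one]
  rw [this, Real.volume_pi_Ioo]
  simp

/-- **The unit pole has residue value `1`** (`= ∫₀¹ 1 dt`, the integral over the face collar of the
residue `1` of `dt/(1-t)` at `t = 1`). [cite: DupontPanzerPym2026, Ex. 7.13] -/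
theorem resValue_unitPole : unitPole.resValue = 1 := by
  rw [IntegralRep.resValue_eq]
  show ∑ i ∈ ({0} : Finset (Fin 1)), ∫ t, rem {0} unitPole.resSys {i} t = 1
  rw [Finset.sum_singleton, rem_unitPole_singleton,
    integral_indicator
      (Literature.ModelTheory.ExponentialFields.IsSemialgebraic.measurableSet_holds
        isSemialgebraic_unitIoo)]
  simp [volume_unitIoo, Measure.real]

/-- The unit pole has regularised value `0`: `eval [unitPole] = 0`. [cite: DupontPanzerPym2026, Ex. 7.13] -/
theorem eval_of_unitPole : eval (of unitPole) = 0 := by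
  rw [eval_of, value_unitPole]

/-- **The unit pole is not a relation** of the regularised calculus (its residue value is `1 ≠ 0`),
although its regularised value is `0`. [folklore] -/
theorem of_unitPole_not_mem_relations : of unitPole ∉ relations := fun h => by
  have h0 := relations_le_ker_res h
  rw [AddMonoidHom.mem_ker, res_of, resValue_unitPole] at h0
  exact one_ne_zero h0

/-- **The regularisation defect of the unit pole is not a relation** — the doubt recorded in the
docstring of `KZreg.KernelConjecture` ("which the four moves of this version do not obviously
provide") is founded. [folklore] -/
theorem regDefect_unitPole_not_mem_relations : regDefect unitPole ∉ relations := fun h => by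
  have h0 := relations_le_ker_res h
  rw [AddMonoidHom.mem_ker, res_regDefect, resValue_unitPole] at h0
  exact one_ne_zero h0

/-- **`KZreg.KernelConjecture` is false.** The route-posed open statement "every formal
`ℤ`-combination of regularised representations of regularised value `0` is a relation of the
regularised calculus" (route KontsevichZagierPeriods/Deregularisation, item RegKernel) fails for the
calculus of `KZRegCalculus.lean`: the unit pole `[(0,1), dt/(1-t); {0}]` has value
`reg ∫₀¹ dt/(1-t) = 0` but is not a relation, because the four moves preserve the residue
functional `res` and `res [unitPole] = 1`. What is missing: in Dupont–Panzer–Pym the value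
`reg ∫₀ᵃ dr/r = log(a/λ)` is DERIVED from the regularised Stokes formula (Cor. 7.11) applied to
`d log r`, the boundary term being the regularised pullbacks `sₐ* log r - s₀* log r` of §5.3
(Ex. 7.13, p. 741); move (d) of this version only allows Stokes along a NON-divergent coordinate,
and move (c) only changes of variables fixing the divergent ones (no change of scale), so no move
pays a pure divergence. [folklore] -/
theorem not_kernelConjecture : ¬ KernelConjecture := fun h =>
  of_unitPole_not_mem_relations (h _ eval_of_unitPole)

/-- Equivalently: the kernel of `eval` is strictly larger than the relations. [folklore] -/
theorem relations_lt_ker_eval : relations < eval.ker :=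
  lt_of_le_of_ne relations_le_ker_eval fun h =>
    of_unitPole_not_mem_relations (h ▸ (by rw [AddMonoidHom.mem_ker, eval_of_unitPole] :
      of unitPole ∈ eval.ker))

/-! ### What the refutation leaves: the kernel statement modulo regularisation defects

The smallest repair suggested by the counterexample is to adjoin the regularisation defects
`regDefect r = [r] - incl (Λ [r])` (all of regularised value `0`) to the relations. No new open
statement is registered here (statement items are the planner's); the following theorems record
that the repaired kernel statement `ker eval ≤ relations ⊔ defects` is implied by the ordinary kernel
conjecture and, together with `Conservative`, equivalent to it — i.e. exactly summit-strength. -/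

/-- The subgroup of `KZreg.FormalRep` generated by the REGULARISATION DEFECTS
`regDefect r = [r] - incl (Λ [r])` (each of regularised value `0`, `eval_regDefect`; not all of
them relations, `regDefect_unitPole_not_mem_relations`). [folklore] -/
def defects : AddSubgroup FormalRep :=
  AddSubgroup.closure (Set.range fun r : Σ n, IntegralRep n => regDefect r.2)

/-- Regularisation defects lie in `defects`. [folklore] -/
theorem regDefect_mem_defects (r : IntegralRep n) : regDefect r ∈ defects :=
  AddSubgroup.subset_closure ⟨⟨n, r⟩, rfl⟩

/-- Defects have regularised value `0`. [folklore] -/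
theorem defects_le_ker_eval : defects ≤ eval.ker := by
  rw [defects]
  refine (AddSubgroup.closure_le _).2 ?_
  rintro _ ⟨⟨n, r⟩, rfl⟩
  exact eval_regDefect r

/-- The de-regularisation kills regularisation defects: `Λ (regDefect r) = 0`. [folklore] -/
theorem Λ_regDefect (r : IntegralRep n) : Λ (regDefect r) = 0 := by
  rw [regDefect, map_sub, Λ_incl, sub_self]

/-- `Λ` vanishes on `defects`. [folklore] -/
theorem defects_le_ker_Λ : defects ≤ Λ.ker := by
  rw [defects]
  refine (AddSubgroup.closure_le _).2 ?_
  rintro _ ⟨⟨n, r⟩, rfl⟩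
  exact Λ_regDefect r

/-- **The defects are not all relations** (the unit pole). [folklore] -/
theorem not_defects_le_relations : ¬ defects ≤ relations := fun h =>
  regDefect_unitPole_not_mem_relations (h (regDefect_mem_defects unitPole))

/-- The enlarged relation set `relations ⊔ defects` is strictly larger than `relations`.
[folklore] -/
theorem relations_lt_relations_sup_defects : relations < relations ⊔ defects :=
  lt_of_le_of_ne le_sup_left fun h => not_defects_le_relations (h ▸ le_sup_right)

/-- The enlarged relation set is still sound: `relations ⊔ defects ≤ ker eval`. [folklore] -/
theorem relations_sup_defects_le_ker_eval : relations ⊔ defects ≤ eval.ker :=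
  sup_le relations_le_ker_eval defects_le_ker_eval

/-- Every formal combination differs from the inclusion of its de-regularisation by a defect:
`d - incl (Λ d) ∈ defects`. [folklore] -/
theorem sub_incl_Λ_mem_defects (d : FormalRep) : d - incl (Λ d) ∈ defects := by
  induction d using FreeAbelianGroup.induction_on with
  | zero => simp [defects.zero_mem]
  | of r =>
    obtain ⟨n, r⟩ := r
    exact regDefect_mem_defects r
  | neg r ih =>
    have : -FreeAbelianGroup.of r - incl (Λ (-FreeAbelianGroup.of r)) =
        -(FreeAbelianGroup.of r - incl (Λ (FreeAbelianGroup.of r))) := by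
      simp only [map_neg]; abel
    rw [this]
    exact defects.neg_mem ih
  | add a b ha hb =>
    have : a + b - incl (Λ (a + b)) = (a - incl (Λ a)) + (b - incl (Λ b)) := by
      simp only [map_add]; abel
    rw [this]
    exact defects.add_mem ha hb

/-- **The ordinary kernel conjecture implies the kernel statement modulo defects**:
`KZKernelConjecture → ker eval ≤ relations ⊔ defects` (write `d = incl (Λ d) + (d - incl (Λ d))`;
the first summand is the inclusion of a KZ relation by `eval_Λ` and `map_relations_le`).
[folklore] -/
theorem ker_eval_le_relations_sup_defects (hk : Transcendental.KZKernelConjecture) :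
    eval.ker ≤ relations ⊔ defects := by
  intro d hd
  rw [AddMonoidHom.mem_ker] at hd
  have h1 : incl (Λ d) ∈ relations := by
    refine map_relations_le ⟨Λ d, hk _ ?_, rfl⟩
    rw [eval_Λ]
    exact hd
  have h2 := sub_incl_Λ_mem_defects d
  have : d = incl (Λ d) + (d - incl (Λ d)) := by abel
  rw [this]
  exact AddSubgroup.add_mem_sup h1 h2

/-- **Under `Conservative`, the kernel statement modulo defects implies the ordinary kernel
conjecture** (`Λ` maps `relations` into `KZ.relations` and kills `defects`, and `Λ ∘ incl = id`).
[folklore] -/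
theorem kzKernelConjecture_of_conservative_of_ker_le (hc : Conservative)
    (hk : eval.ker ≤ relations ⊔ defects) : Transcendental.KZKernelConjecture := by
  intro c h0
  have h1 : incl c ∈ relations ⊔ defects :=
    hk (by rw [AddMonoidHom.mem_ker, eval_incl]; exact h0)
  have h2 : relations ⊔ defects ≤ KZ.relations.comap Λ := by
    refine sup_le (conservative_iff_le_comap.1 hc) fun x hx => ?_
    have hx0 : Λ x = 0 := defects_le_ker_Λ hx
    rw [AddSubgroup.mem_comap, hx0]
    exact zero_mem _
  have := h2 h1
  rwa [AddSubgroup.mem_comap, Λ_incl] at this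

/-- **The corrected sandwich.** `Conservative ∧ (ker eval ≤ relations ⊔ defects)` is EQUIVALENT to
the ordinary kernel conjecture `KZKernelConjecture` (itself equivalent to the summit
`KontsevichZagierPeriods` elsewhere in the tree): with the defects adjoined, the regularised detour
of route Deregularisation is exactly summit-strength, neither more nor less. [folklore] -/
theorem conservative_and_ker_le_iff :
    (Conservative ∧ eval.ker ≤ relations ⊔ defects) ↔ Transcendental.KZKernelConjecture :=
  ⟨fun h => kzKernelConjecture_of_conservative_of_ker_le h.1 h.2,
    fun hk => ⟨conservative_of_kzKernelConjecture hk, ker_eval_le_relations_sup_defects hk⟩⟩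

end KZreg

end Literature.NumberTheory.Transcendental
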